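import Summits.SmoothPoincare4.SmoothPoincare4.Theorems.ConvexBisectionAcyclicBisectionExistsMultiAttachmentSplit
import Summits.SmoothPoincare4.SmoothPoincare4.Theorems.ConvexBisectionAcyclicBisectionExistsDualHandlePlumbing
import HarnessLib

/-!
# Dual handles, IV: the COMPATIBLE splitting `X = (B ∪ prefix) ∪ suffix` of a multi-attachment
(brick (i) of the sub-goal T3b "the complement of the prefix sub-handlebody is the other piece with
the DUAL suffix handles" of stub `stub_steinRealisation` (NF6), line `modp-braid-orbits` r11, crux
`ConvexBisection.AcyclicBisectionExists`, item stmt-SmoothPoincare4-10508; wave 2, lead c5)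

The landed splitting `helper_isMultiAttachment_split` (`…MultiAttachmentSplit.lean`; Kosinski 1993,
VI (7.1): handles of one index *"can all be attached at the same time"*, and conversely in two
batches) produces, for `X = B ∪_{h̄} (k = m + n handles)`, the prefix sub-handlebody
`X₁ = B ∪ (h̄ᵢ)_{i<m}` with data `D₁` and the PREDICATE "`X` is `X₁` with the lifted suffix maps
attached".  The dual-handle presentation of the complement piece (node T3b of the T3 design) needs
the DATA of that second attachment ON `X` ITSELF and COMPATIBLE with the given data `D` of `X`:

* `MultiAttachmentData.exists_compatible_diffeomorph` — **compatible uniqueness**: for two data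
  `D`, `D'` of attachments of the same family to `P`, `P'`, the comparison diffeomorphism
  `G : P ≅ P'` of Kosinski's uniqueness (VI §1, proof of (1.1); the tree's
  `IsMultiAttachment.nonempty_diffeomorph`) satisfies `G ∘ D.jA = D'.jA`, `G ∘ D.jB i = D'.jB i`
  (the proof of the tree's theorem already builds `G` this way; here the equations are exported);
* `MultiAttachmentData.mapDiffeo` — transport of data along a diffeomorphism of the attached
  manifold; `MultiAttachmentData.reindexData` — re-indexing data along a bijection of the index
  types (same `M`-piece embedding, permuted handles);
* `exists_compatible_split` — **for data `D` of `X = B ∪_{h̄} (handles)`, `h̄ : Fin k → …`,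
  `k = m + n`: a compact `X₁ = B ∪ (prefix)` with data `D₁` and data `D₂` of
  `X = X₁ ∪ (lifted suffix)` such that `D₂.jA ∘ D₁.jA = D.jA` on `B ∖ ⋃ h̄ᵢ(S)`,
  `D₂.jA ∘ D₁.jB i = D.jB (prefix i)` and `D₂.jB j = D.jB (suffix j)`** (indices
  `Fin.cast _ (Fin.castAdd n i)`, `Fin.cast _ (Fin.natAdd m j)` as in
  `helper_isMultiAttachment_split_append` and in the T3 design file);
* `helper_compatible_split` (registered) — the same in tree vocabulary.

Everything here is proved; no named facts.

## References
* A. A. Kosinski, *Differential Manifolds*, Academic Press (1993), VI §1 (proof of (1.1)), VI §6,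
  (7.1), VII proof of (1.2). [Kosinski1993]
* J. Milnor, *Lectures on the h-cobordism theorem* (1965), §3. [MilnorHCobordism1965]
-/

noncomputable section

-- the prescribed namespace `Summit.<P>.<Sub>.…` duplicates `SmoothPoincare4` (P = Sub)
set_option linter.dupNamespace false

open scoped Manifold ContDiff Topology

namespace Summit.SmoothPoincare4.SmoothPoincare4.Theorems.AcyclicBisectionExists.ModpBraidOrbits

open Set Function
open Literature.Topology.FourManifolds Literature.Topology.FourManifolds.HandleAttachingMap

universe u

/-! ### §1 Compatible uniqueness, transport and re-indexing of multi-attachment DATA -/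

section DataTools

variable {n k : ℕ} {M : Type u} [TopologicalSpace M] [T2Space M]
  [ChartedSpace (EuclideanHalfSpace (n + 1)) M]
  {ι : Type*} [Finite ι] {h : ι → HandleAttachingMap n k M}
  {EP HP EP' HP' : Type*} [NormedAddCommGroup EP] [NormedSpace ℝ EP] [TopologicalSpace HP]
  {IP : ModelWithCorners ℝ EP HP} [NormedAddCommGroup EP'] [NormedSpace ℝ EP']
  [TopologicalSpace HP'] {IP' : ModelWithCorners ℝ EP' HP'}
  {P : Type*} [TopologicalSpace P] [ChartedSpace HP P]
  {P' : Type*} [TopologicalSpace P'] [ChartedSpace HP' P']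

/-- **Compatible uniqueness of `M ∪ H^λ ∪ ⋯ ∪ H^λ`.**  For data `D`, `D'` exhibiting `P`, `P'` as
`M` with handles attached along the same family `h̄`, the comparison map `D.jA a ↦ D'.jA a`,
`D.jB i b ↦ D'.jB i b` (well defined since both covers meet exactly along Kosinski's relation) is a
diffeomorphism `G : P ≅ P'` with `G (D.jA a) = D'.jA a` and `G (D.jB i b) = D'.jB i b` — Kosinski's
*"unique structure for which the projections are diffeomorphisms"* (VI §1, proof of (1.1)), with
the defining equations exported. [cite: Kosinski1993, Ch. VI §1, proof of Thm (1.1)] -/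
theorem _root_.Literature.Topology.FourManifolds.HandleAttachingMap.MultiAttachmentData.exists_compatible_diffeomorph
    [IsManifold IP ∞ P] [IsManifold IP' ∞ P']
    (D : MultiAttachmentData h IP P) (D' : MultiAttachmentData h IP' P') :
    ∃ G : P ≃ₘ⟮IP, IP'⟯ P', (∀ a, G (D.jA a) = D'.jA a) ∧ ∀ i b, G (D.jB i b) = D'.jB i b := by
  have hRR' : ∀ i a b, D.jA a = D.jB i b → D'.jA a = D'.jB i b := fun i a b e =>
    (D'.glue i a b).2 ((D.glue i a b).1 e)
  have hR'R : ∀ i a b, D'.jA a = D'.jB i b → D.jA a = D.jB i b := fun i a b e =>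
    (D.glue i a b).2 ((D'.glue i a b).1 e)
  obtain ⟨G, hGA, hGB⟩ := exists_map_apply_eq_of_cover_family D.cover D.injective_jA
    D.injective_jB D.disjointB hRR'
  obtain ⟨G', hGA', hGB'⟩ := exists_map_apply_eq_of_cover_family D'.cover D'.injective_jA
    D'.injective_jB D'.disjointB hR'R
  refine ⟨⟨⟨G, G', fun p => ?_, fun p => ?_⟩,
      contMDiff_of_comp_eq_of_cover_family D.hjA D.hjAo (fun i => (D.hjB i).1)
        (fun i => (D.hjB i).2) D.cover D'.hjA.contMDiff (fun i => (D'.hjB i).1.contMDiff) hGA hGB,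
      contMDiff_of_comp_eq_of_cover_family D'.hjA D'.hjAo (fun i => (D'.hjB i).1)
        (fun i => (D'.hjB i).2) D'.cover D.hjA.contMDiff (fun i => (D.hjB i).1.contMDiff) hGA' hGB'⟩,
    hGA, hGB⟩
  · rcases D.mem_range_or p with ⟨a, rfl⟩ | ⟨i, b, rfl⟩
    · show G' (G (D.jA a)) = D.jA a
      rw [hGA, hGA']
    · show G' (G (D.jB i b)) = D.jB i b
      rw [hGB, hGB']
  · rcases D'.mem_range_or p with ⟨a, rfl⟩ | ⟨i, b, rfl⟩
    · show G (G' (D'.jA a)) = D'.jA a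
      rw [hGA', hGA]
    · show G (G' (D'.jB i b)) = D'.jB i b
      rw [hGB', hGB]

/-- **Transport of multi-attachment data along a diffeomorphism of the attached manifold**
(same attaching maps): compose the embeddings of the pieces with the diffeomorphism
(Kosinski VI §1, §6: `M ∪ H^λ` is well defined up to diffeomorphism). [cite: Kosinski1993, VI §6] -/
def _root_.Literature.Topology.FourManifolds.HandleAttachingMap.MultiAttachmentData.mapDiffeo
    {HQ : Type*} [TopologicalSpace HQ] {IQ : ModelWithCorners ℝ EP HQ}
    {Q : Type*} [TopologicalSpace Q] [ChartedSpace HQ Q] [IsManifold IQ ∞ Q]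
    {Q' : Type*} [TopologicalSpace Q'] [ChartedSpace HQ Q'] [IsManifold IQ ∞ Q']
    (D : MultiAttachmentData h IQ Q) (G : Q ≃ₘ⟮IQ, IQ⟯ Q') : MultiAttachmentData h IQ Q' where
  disjoint := D.disjoint
  jA := G ∘ D.jA
  jB i := G ∘ D.jB i
  hjA := D.hjA.diffeomorph_comp G
  hjAo := by rw [range_comp]; exact G.toHomeomorph.isOpenMap _ D.hjAo
  hjB i := ⟨(D.hjB i).1.diffeomorph_comp G, by
    rw [range_comp]; exact G.toHomeomorph.isOpenMap _ (D.hjB i).2⟩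
  cover := by
    have : range (G ∘ D.jA) ∪ ⋃ i, range (G ∘ D.jB i) = G '' (range D.jA ∪ ⋃ i, range (D.jB i)) := by
      rw [image_union, image_iUnion, range_comp]
      simp_rw [range_comp]
    rw [this, D.cover, image_univ]
    exact G.toEquiv.range_eq_univ
  glue i a b := by
    rw [← D.glue i a b]
    exact G.injective.eq_iff
  disjointB i j hij := by
    refine Set.disjoint_left.2 ?_
    rintro _ ⟨b, rfl⟩ ⟨b', he⟩
    exact Set.disjoint_left.1 (D.disjointB hij) (mem_range_self b) ⟨b', G.injective he⟩

/-- `mapDiffeo` on the `M`-piece (definitional). [folklore] -/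
@[simp] theorem _root_.Literature.Topology.FourManifolds.HandleAttachingMap.MultiAttachmentData.mapDiffeo_jA
    {HQ : Type*} [TopologicalSpace HQ] {IQ : ModelWithCorners ℝ EP HQ}
    {Q : Type*} [TopologicalSpace Q] [ChartedSpace HQ Q] [IsManifold IQ ∞ Q]
    {Q' : Type*} [TopologicalSpace Q'] [ChartedSpace HQ Q'] [IsManifold IQ ∞ Q']
    (D : MultiAttachmentData h IQ Q) (G : Q ≃ₘ⟮IQ, IQ⟯ Q') (a : ↥(coresComplement h)) :
    (D.mapDiffeo G).jA a = G (D.jA a) := rfl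

/-- `mapDiffeo` on the handles (definitional). [folklore] -/
@[simp] theorem _root_.Literature.Topology.FourManifolds.HandleAttachingMap.MultiAttachmentData.mapDiffeo_jB
    {HQ : Type*} [TopologicalSpace HQ] {IQ : ModelWithCorners ℝ EP HQ}
    {Q : Type*} [TopologicalSpace Q] [ChartedSpace HQ Q] [IsManifold IQ ∞ Q]
    {Q' : Type*} [TopologicalSpace Q'] [ChartedSpace HQ Q'] [IsManifold IQ ∞ Q']
    (D : MultiAttachmentData h IQ Q) (G : Q ≃ₘ⟮IQ, IQ⟯ Q') (i : ι) (b : ↥(beltPiece n k)) :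
    (D.mapDiffeo G).jB i b = G (D.jB i b) := rfl

variable {ι' : Type*} [Finite ι'] {h' : ι' → HandleAttachingMap n k M}

/-- Along a bijection `e` with `h' i' = h (e i')` the two families have the same cores complement.
[folklore] -/
theorem mem_coresComplement_iff_of_eq_comp (e : ι' ≃ ι) (he : ∀ i', h' i' = h (e i')) {a : M} :
    a ∈ coresComplement h' ↔ a ∈ coresComplement h := by
  simp only [mem_coresComplement]
  constructor
  · intro H i
    have := H (e.symm i)
    rwa [he, e.apply_symm_apply] at this
  · intro H i'
    rw [he]
    exact H (e i')

/-- The identification `M ∖ ⋃ h'(S) ≅ M ∖ ⋃ h̄(S)` of the (equal) cores complements, as a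
diffeomorphism (restricted identity). [folklore] -/
def reindexCongr [IsManifold (𝓡∂ (n + 1)) ∞ M] (e : ι' ≃ ι) (he : ∀ i', h' i' = h (e i')) :
    ↥(coresComplement h') ≃ₘ⟮𝓡∂ (n + 1), 𝓡∂ (n + 1)⟯ ↥(coresComplement h) :=
  opensCongr (Diffeomorph.refl (𝓡∂ (n + 1)) M ∞) _ _ fun _ => mem_coresComplement_iff_of_eq_comp e he

/-- `reindexCongr` is the identity on points. [folklore] -/
@[simp] theorem coe_reindexCongr [IsManifold (𝓡∂ (n + 1)) ∞ M] (e : ι' ≃ ι)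
    (he : ∀ i', h' i' = h (e i')) (a : ↥(coresComplement h')) :
    ((reindexCongr e he a : ↥(coresComplement h)) : M) = a := rfl

/-- **Re-indexing multi-attachment data along a bijection of the index types**: if `P` is `M` with
handles attached along `(h̄ᵢ)_{i ∈ ι}` (data `D`) and `h' i' = h̄ (e i')` for a bijection `e`, then
`P` is `M` with handles attached along `h'` — same embedding of the `M`-piece, handle embeddings
`D.jB (e i')` (the data form of the tree's `IsMultiAttachment.reindex`). [folklore] -/
def _root_.Literature.Topology.FourManifolds.HandleAttachingMap.MultiAttachmentData.reindexData
    [IsManifold (𝓡∂ (n + 1)) ∞ M] [IsManifold IP ∞ P]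
    (D : MultiAttachmentData h IP P) (e : ι' ≃ ι) (he : ∀ i', h' i' = h (e i')) :
    MultiAttachmentData h' IP P where
  disjoint i' j' hne := by
    change Disjoint (range (h' i').toFun) (range (h' j').toFun)
    rw [he, he]
    exact D.disjoint fun c => hne (e.injective c)
  jA := D.jA ∘ reindexCongr e he
  jB i' := D.jB (e i')
  hjA := D.hjA.comp_openPartialHomeomorph (reindexCongr e he).toHomeomorph.toOpenPartialHomeomorph rfl
      ((reindexCongr e he).contMDiff.contMDiffOn.congr fun _ _ => rfl)
      ((reindexCongr e he).symm.contMDiff.contMDiffOn.congr fun _ _ => rfl)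
  hjAo := by
    have hr : range (D.jA ∘ reindexCongr e he) = range D.jA :=
      (reindexCongr e he).surjective.range_comp D.jA
    rw [hr]
    exact D.hjAo
  hjB i' := D.hjB (e i')
  cover := by
    have hr : range (D.jA ∘ reindexCongr e he) = range D.jA :=
      (reindexCongr e he).surjective.range_comp D.jA
    rw [hr, show (⋃ i', range (D.jB (e i'))) = ⋃ i, range (D.jB i) from
        e.surjective.iUnion_comp fun i => range (D.jB i)]
    exact D.cover
  glue i' a b := by
    rw [Function.comp_apply, D.glue (e i') (reindexCongr e he a) b, coe_reindexCongr, he]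
  disjointB i' j' hne := D.disjointB fun c => hne (e.injective c)

/-- `reindexData` on the `M`-piece: the same point of `M`. [folklore] -/
theorem _root_.Literature.Topology.FourManifolds.HandleAttachingMap.MultiAttachmentData.reindexData_jA
    [IsManifold (𝓡∂ (n + 1)) ∞ M] [IsManifold IP ∞ P]
    (D : MultiAttachmentData h IP P) (e : ι' ≃ ι) (he : ∀ i', h' i' = h (e i'))
    (a : ↥(coresComplement h')) :
    (D.reindexData e he).jA a = D.jA ⟨a, (mem_coresComplement_iff_of_eq_comp e he).1 a.2⟩ := rfl

/-- `reindexData` on the handles: `D.jB (e i')`. [folklore] -/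
@[simp] theorem _root_.Literature.Topology.FourManifolds.HandleAttachingMap.MultiAttachmentData.reindexData_jB
    [IsManifold (𝓡∂ (n + 1)) ∞ M] [IsManifold IP ∞ P]
    (D : MultiAttachmentData h IP P) (e : ι' ≃ ι) (he : ∀ i', h' i' = h (e i')) (i' : ι')
    (b : ↥(beltPiece n k)) : (D.reindexData e he).jB i' b = D.jB (e i') b := rfl

end DataTools

/-! ### §2 The compatible splitting -/

section Main

variable {B : Type} [TopologicalSpace B] [T2Space B] [SecondCountableTopology B] [CompactSpace B]
  [ChartedSpace (EuclideanHalfSpace 4) B] [IsManifold (𝓡∂ 4) ∞ B]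

/-- `Fin m ⊕ Fin n ≃ Fin k` (`k = m + n`) realises the prefix/suffix indices
`Fin.cast _ (Fin.castAdd n i)`, `Fin.cast _ (Fin.natAdd m j)`. [folklore] -/
theorem sumElim_cast_castAdd_natAdd_of_eq {α : Type*} {m n k : ℕ} (hk : k = m + n) (h : Fin k → α)
    (x : Fin m ⊕ Fin n) :
    Sum.elim (fun i => h (Fin.cast hk.symm (Fin.castAdd n i)))
        (fun j => h (Fin.cast hk.symm (Fin.natAdd m j))) x =
      h ((finSumFinEquiv.trans (finCongr hk.symm)) x) := by
  cases x <;> simp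

/-- **The compatible splitting `X = (B ∪ prefix) ∪ suffix` of multi-attachment DATA.**  Let
`X = B ∪_{h̄} (k = m + n handles)` with data `D` (`B` compact).  Then there are a compact
`X₁ = B ∪ (h̄_{prefix i})_{i<m}` with data `D₁` (`exists_isMultiAttachment_holds`) and DATA `D₂`
exhibiting `X` ITSELF as `X₁` with the lifted suffix maps `D₁.lift (h̄ (suffix j))` attached, which
are compatible with `D`: the `B`-piece of `X` is embedded by `D₂.jA ∘ D₁.jA = D.jA`, the prefix
handles by `D₂.jA ∘ D₁.jB i = D.jB (prefix i)`, the suffix handles by `D₂.jB j = D.jB (suffix j)`.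
Proof: attach the lifted suffix maps to `X₁` abstractly (`X'`, data `D₂'`), assemble the data of
`X' = B ∪ (prefix, suffix)` (`splitData`, Kosinski VI (7.1)), compare it with the re-indexed `D` by
the COMPATIBLE uniqueness diffeomorphism `G : X' ≅ X` (`exists_compatible_diffeomorph`), and
transport `D₂'` along `G`. [cite: Kosinski1993, VI (7.1)] -/
theorem exists_compatible_split (m n : ℕ) {k : ℕ} (hk : k = m + n) (h : Fin k → HandleAttachingMap 3 2 B)
    {X : Type} [TopologicalSpace X] [T2Space X] [ChartedSpace (EuclideanHalfSpace 4) X]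
    [IsManifold (𝓡∂ 4) ∞ X] (D : MultiAttachmentData h (𝓡∂ 4) X) :
    ∃ (X₁ : Type) (_ : TopologicalSpace X₁) (_ : T2Space X₁) (_ : SecondCountableTopology X₁)
      (_ : CompactSpace X₁) (_ : ChartedSpace (EuclideanHalfSpace 4) X₁) (_ : IsManifold (𝓡∂ 4) ∞ X₁)
      (D₁ : MultiAttachmentData (fun i : Fin m => h (Fin.cast hk.symm (Fin.castAdd n i))) (𝓡∂ 4) X₁)
      (D₂ : MultiAttachmentData
        (fun j : Fin n => D₁.lift (h (Fin.cast hk.symm (Fin.natAdd m j)))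
          (disjoint_range_natAdd_castAdd hk D j)) (𝓡∂ 4) X),
      (∀ (a : ↥(coresComplement h))
        (ha₁ : (a : B) ∈ coresComplement fun i : Fin m => h (Fin.cast hk.symm (Fin.castAdd n i)))
        (ha₂ : D₁.jA ⟨a, ha₁⟩ ∈ coresComplement fun j : Fin n =>
          D₁.lift (h (Fin.cast hk.symm (Fin.natAdd m j))) (disjoint_range_natAdd_castAdd hk D j)),
        D₂.jA ⟨D₁.jA ⟨a, ha₁⟩, ha₂⟩ = D.jA a) ∧
      (∀ (i : Fin m) (b : ↥(beltPiece 3 2))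
        (hb : D₁.jB i b ∈ coresComplement fun j : Fin n =>
          D₁.lift (h (Fin.cast hk.symm (Fin.natAdd m j))) (disjoint_range_natAdd_castAdd hk D j)),
        D₂.jA ⟨D₁.jB i b, hb⟩ = D.jB (Fin.cast hk.symm (Fin.castAdd n i)) b) ∧
      ∀ (j : Fin n) (b : ↥(beltPiece 3 2)), D₂.jB j b = D.jB (Fin.cast hk.symm (Fin.natAdd m j)) b := by
  -- the prefix and suffix families, the bijection of indices
  set p : Fin m → HandleAttachingMap 3 2 B := fun i => h (Fin.cast hk.symm (Fin.castAdd n i)) with hp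
  set q : Fin n → HandleAttachingMap 3 2 B := fun j => h (Fin.cast hk.symm (Fin.natAdd m j)) with hq
  set e : Fin m ⊕ Fin n ≃ Fin k := finSumFinEquiv.trans (finCongr hk.symm) with he_def
  have he : ∀ x, Sum.elim p q x = h (e x) := sumElim_cast_castAdd_natAdd_of_eq hk h
  have hqp : ∀ (j : Fin n) (i : Fin m), Disjoint (range (q j).toFun) (range (p i).toFun) :=
    fun j i => disjoint_range_natAdd_castAdd hk D j i
  -- `X₁ = B ∪ p`
  obtain ⟨X₁, _, _, _, hT2, hSC, hcpt, hX₁⟩ :=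
    exists_isMultiAttachment_holds 3 2 B (Fin m) p (pairwise_disjoint_of_sumElim_eq e he D.disjoint)
  haveI := hT2
  haveI := hSC
  haveI : CompactSpace X₁ := hcpt inferInstance
  set D₁ : MultiAttachmentData p (𝓡∂ 4) X₁ := hX₁.multiAttachmentData with hD₁
  -- `X' = X₁ ∪ (lifted q)`, abstractly
  have hqq : Pairwise fun j j' => Disjoint (range (q j).toFun) (range (q j').toFun) :=
    fun j j' hne => by
      rw [hq]
      exact D.disjoint fun c => hne (by
        have := congrArg Fin.val c
        simp at this
        exact Fin.ext this)
  obtain ⟨X', _, _, _, hT2', hSC', -, hX'⟩ := exists_isMultiAttachment_holds 3 2 X₁ (Fin n)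
    (fun j => D₁.lift (q j) (hqp j)) (pairwise_disjoint_lift D₁ hqp hqq)
  haveI := hT2'
  set D₂' : MultiAttachmentData (fun j => D₁.lift (q j) (hqp j)) (𝓡∂ 4) X' :=
    hX'.multiAttachmentData with hD₂'
  -- compare `splitData D₁ hqp D₂'` (on `X'`) with the re-indexed `D` (on `X`)
  obtain ⟨G, hGA, hGB⟩ := (splitData D₁ hqp D₂').exists_compatible_diffeomorph (D.reindexData e he)
  refine ⟨X₁, _, hT2, hSC, inferInstance, _, _, D₁, D₂'.mapDiffeo G, ?_, ?_, ?_⟩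
  · intro a ha₁ ha₂
    have haq : ∀ j, (a : B) ∉ (q j).core := fun j => (mem_coresComplement h).1 a.2 _
    set a' : ↥(coresComplement (Sum.elim p q)) := ⟨a, mem_coresComplement_sumElim_iff.2 ⟨ha₁, haq⟩⟩
      with ha'
    have h1 : (⟨D₁.jA ⟨a, ha₁⟩, ha₂⟩ : ↥(coresComplement fun j => D₁.lift (q j) (hqp j))) =
        splitPtA D₁ hqp a' := Subtype.ext rfl
    rw [MultiAttachmentData.mapDiffeo_jA, h1, ← splitJA_apply]
    exact hGA a'
  · intro i b hb
    have h1 : (⟨D₁.jB i b, hb⟩ : ↥(coresComplement fun j => D₁.lift (q j) (hqp j))) =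
        splitPtB D₁ hqp i b := Subtype.ext rfl
    rw [MultiAttachmentData.mapDiffeo_jA, h1]
    have h2 := hGB (Sum.inl i) b
    rw [MultiAttachmentData.reindexData_jB] at h2
    exact h2
  · intro j b
    rw [MultiAttachmentData.mapDiffeo_jB]
    have h2 := hGB (Sum.inr j) b
    rw [MultiAttachmentData.reindexData_jB] at h2
    exact h2

/-- **Registered helper `helper_compatible_split` (brick (i) of T3b, sub-goal of NF6
`stub_steinRealisation`, wave 2, lead c5): the compatible splitting of multi-attachment data.**
For data `D` of `X = B ∪_{h̄} (k = m + n handles)` over a compact `B`: a compact `X₁ = B ∪ (prefix)`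
with data `D₁` and data `D₂` of `X = X₁ ∪ (lifted suffix)` with `D₂.jA ∘ D₁.jA = D.jA`,
`D₂.jA ∘ D₁.jB i = D.jB (prefix i)`, `D₂.jB j = D.jB (suffix j)` (Kosinski 1993, VI (7.1) with the
compatible form of the uniqueness VI §1 (1.1)). [cite: Kosinski1993, VI (7.1)] -/
theorem helper_compatible_split : ∀ {B : Type} [TopologicalSpace B] [T2Space B] [SecondCountableTopology B] [CompactSpace B] [ChartedSpace (EuclideanHalfSpace 4) B] [IsManifold (𝓡∂ 4) ∞ B] (m n : ℕ) {k : ℕ} (hk : k = m + n) (h : Fin k → Literature.Topology.FourManifolds.HandleAttachingMap 3 2 B) {X : Type} [TopologicalSpace X] [T2Space X] [ChartedSpace (EuclideanHalfSpace 4) X] [IsManifold (𝓡∂ 4) ∞ X] (D : Literature.Topology.FourManifolds.HandleAttachingMap.MultiAttachmentData h (𝓡∂ 4) X), ∃ (X₁ : Type) (_ : TopologicalSpace X₁) (_ : T2Space X₁) (_ : SecondCountableTopology X₁) (_ : CompactSpace X₁) (_ : ChartedSpace (EuclideanHalfSpace 4) X₁) (_ : IsManifold (𝓡∂ 4) ∞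 X₁) (D₁ : Literature.Topology.FourManifolds.HandleAttachingMap.MultiAttachmentData (fun i : Fin m => h (Fin.cast hk.symm (Fin.castAdd n i))) (𝓡∂ 4) X₁) (D₂ : Literature.Topology.FourManifolds.HandleAttachingMap.MultiAttachmentData (fun j : Fin n => D₁.lift (h (Fin.cast hk.symm (Fin.natAdd m j))) (Summit.SmoothPoincare4.SmoothPoincare4.Theorems.AcyclicBisectionExists.ModpBraidOrbits.disjoint_range_natAdd_castAdd hk D j)) (𝓡∂ 4) X), (∀ (a : ↥(Literature.Topology.FourManifolds.HandleAttachingMap.coresComplement h)) (ha₁ : (a : B) ∈ Literature.Topology.FourManifolds.HandleAttachingMap.coresComplement fun i : Fin m => h (Fin.cast hk.symm (Fin.castAdd n i))) (ha₂ : D₁.jA ⟨a, ha₁⟩ ∈ Literature.Topology.FourManifolds.HandleAttachingMap.coresComplement fun j : Fin n => D₁.lift (h (Fin.cast hk.symm (Fin.natAdd m j))) (Summit.SmoothPoincare4.SmoothPoincare4.Theorems.AcyclicBisectionExists.ModpBraidOrbits.disjoint_range_natAdd_castAdd hk D j)), D₂.jA ⟨D₁.jA ⟨a, ha₁⟩,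 ha₂⟩ = D.jA a) ∧ (∀ (i : Fin m) (b : ↥(Literature.Topology.FourManifolds.beltPiece 3 2)) (hb : D₁.jB i b ∈ Literature.Topology.FourManifolds.HandleAttachingMap.coresComplement fun j : Fin n => D₁.lift (h (Fin.cast hk.symm (Fin.natAdd m j))) (Summit.SmoothPoincare4.SmoothPoincare4.Theorems.AcyclicBisectionExists.ModpBraidOrbits.disjoint_range_natAdd_castAdd hk D j)), D₂.jA ⟨D₁.jB i b, hb⟩ = D.jB (Fin.cast hk.symm (Fin.castAdd n i)) b) ∧ ∀ (j : Fin n) (b : ↥(Literature.Topology.FourManifolds.beltPiece 3 2)), D₂.jB j b = D.jB (Fin.cast hk.symm (Fin.natAdd m j)) b :=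
  fun m n _ hk h _ _ _ _ _ D => exists_compatible_split m n hk h D

end Main

end Summit.SmoothPoincare4.SmoothPoincare4.Theorems.AcyclicBisectionExists.ModpBraidOrbits

end
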